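import Literature.Analysis.FunctionSpaces.TorusClassicalNSRestart
import Literature.Analysis.FunctionSpaces.TorusClassicalNSUniqueness
import HarnessLib

/-!
# Classical Navier–Stokes solutions on the flat torus: patching finite horizons to `[0, ∞)`

Function-space support file (all results proved; no definitions, no named facts) for the
accepted notion `Torus.IsClassicalNSSolutionOn S ν f u p` of `TorusFluidGlue`, continuing
`TorusClassicalNSGluing` / `TorusClassicalNSRestart` (restriction, pressure normalisation, gluing
on OPEN time sets, locality) and `TorusClassicalNSUniqueness` (forward uniqueness, `ν ≥ 0`). It
supplies the elementary equivalence used — usually tacitly — whenever a periodic global-regularity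
statement is phrased "for every `T > 0` there is a smooth solution on `[0, T)`" instead of
Fefferman's "smooth on `[0, ∞)`" ((B), (11)):

* `Torus.IsClassicalNSSolutionOn.gradient_pressure_eq_of_eqOn`,
  `Torus.IsClassicalNSSolutionOn.pressure_sub_eq_of_eqOn` — two classical solutions on the SAME
  time set with the same velocity have the same pressure gradient, hence pressures differing by a
  function of time (the versions of `…_of_eventuallyEq` of `TorusClassicalNSGluing` that also hold
  at a boundary time such as `t = 0`, where the time derivative is one-sided);
* `Torus.IsClassicalNSSolutionOn.of_local_within` — **being a classical solution is local in
  time, on ANY time set** `S`: a pair `(u, p)` which on `S ∩ V`, `V` an open neighbourhood of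
  `t`, agrees with a classical solution on `S ∩ V`, for every `t ∈ S`, is a classical solution on
  `S` (the within-`S` time derivative at `t` only sees `S ∩ V`, Mathlib `derivWithin_inter`;
  joint smoothness is local, `contDiffOn_of_locally_contDiffOn`) — the relatively-open twin of
  `Torus.IsClassicalNSSolutionOn.of_local` (`TorusClassicalNSRestart`, open `S` only);
* `Torus.IsClassicalNSSolutionOn.eq_on_Ico` — two classical solutions on `[0, T₁)` and `[0, T₂)`
  with the same datum agree on the common horizon (`velocity_unique` on each `[0, t]`);
* `Torus.IsClassicalNSSolutionOn.exists_Ici_of_forall_Ico` — **PATCHING**: if for every `T > 0`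
  the Cauchy problem (viscosity `ν ≥ 0`, force `f`, datum `u₀`) has a classical solution on
  `[0, T) × 𝕋ᵈ`, then it has one on `[0, ∞) × 𝕋ᵈ` (take the solution with horizon `⌊t⌋₊ + 1`
  at time `t`, pressures normalised at a base point; consecutive choices agree by uniqueness, so
  the patched pair is locally one of them); with the converses by restriction,
  `Torus.IsClassicalNSSolutionOn.exists_Ici_iff_forall_Ico` and `…_iff_forall_Icc`
  ("a smooth solution on `[0, T]` for every `T`" ⇔ "a smooth solution on `[0, ∞)`").

This is the (folklore) last sentence of every continuation argument — Robinson–Rodrigo–Sadowski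
2016, §8.1 (restart at a later time, identify on the overlap by uniqueness, Lemma 6.11 / Thm. 6.10)
and Majda–Bertozzi 2002, Cor. 3.1 (uniqueness of smooth solutions, any `ν ≥ 0`) — written for a
countable family of horizons at once. Consumed by `Literature/Claims/NS/ClayHorizonBridge` (the
Clay (B)/(D) reference of the D-0090 claims map: finite-horizon formulations are EQUIVALENT to
(B), not a «wrong problem» delta).

## Mathlib / tree search

Tree (`lean search 'exists_Ici|of_local|glue'`): `Torus.IsClassicalNSSolutionOn.of_local`,
`….sub_pressure_apply`, `….glue_Ioo` (`TorusClassicalNSRestart`, open time sets),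
`….glue_Ioi`, `….pressure_sub_eq_of_eventuallyEq`, `….mono`,
`Torus.IsSmoothSpaceTimeOn.sub_slice_apply_const` (`TorusClassicalNSGluing`),
`….velocity_unique` (`TorusClassicalNSUniqueness`); nothing for closed/half-open time sets or
countably many horizons. Mathlib: `contDiffOn_of_locally_contDiffOn`, `derivWithin_inter`,
`derivWithin_congr`, `is_const_of_fderiv_eq_zero`, `Nat.lt_floor_add_one`, `Nat.floor_lt`.

## References

* J. C. Robinson, J. L. Rodrigo, W. Sadowski, *The Three-Dimensional Navier–Stokes Equations.
  Classical Theory*, CUP 2016, §6.3 (Thm. 6.10, Lemma 6.11) and §8.1. [RobinsonRodrigoSadowskiCUP2016]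
* A. J. Majda, A. L. Bertozzi, *Vorticity and Incompressible Flow*, CUP 2002, §3.1.1, Cor. 3.1.
  [MajdaBertozziCUP2002]
* C. L. Fefferman, *Existence and smoothness of the Navier–Stokes equation*, CMI 2006, (B) with
  (8), (10), (11). [FeffermanClay2006]

WHAT THIS IS NOT: not a claim about NS regularity or blow-up; not a claim about any author beyond
the typed locator.
-/

open MeasureTheory Set Filter
open _root_.Topology
open scoped InnerProductSpace ContDiff

noncomputable section

namespace Literature.Analysis.FunctionSpaces

namespace Torus

variable {d : Type*} [Fintype d] [DecidableEq d]
variable {ν : ℝ} {f : ℝ → UnitAddTorus d → EuclideanSpace ℝ d}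

/-! ## Two solutions on the same time set with the same velocity -/

section SameSet

variable {S : Set ℝ} {u₁ u₂ : ℝ → UnitAddTorus d → EuclideanSpace ℝ d}
  {p₁ p₂ : ℝ → UnitAddTorus d → ℝ}

/-- **The velocity determines the pressure gradient (same time set, boundary times included).**
Two classical solutions on the same time set `S` (same viscosity and force) whose velocities agree
on `S` have the same pressure gradient at every `t ∈ S`: the one-sided time derivatives within `S`
of fields agreeing on `S` coincide (Mathlib `derivWithin_congr`); subtract the momentum equations.
[cite: RobinsonRodrigoSadowskiCUP2016, §8.1] -/
theorem IsClassicalNSSolutionOn.gradient_pressure_eq_of_eqOn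
    (h₁ : IsClassicalNSSolutionOn S ν f u₁ p₁) (h₂ : IsClassicalNSSolutionOn S ν f u₂ p₂)
    (heq : ∀ τ ∈ S, u₁ τ = u₂ τ) {t : ℝ} (ht : t ∈ S) (x : UnitAddTorus d) :
    gradient (p₁ t) x = gradient (p₂ t) x := by
  have hd : timeDerivWithin S u₁ t x = timeDerivWithin S u₂ t x := by
    simp only [timeDerivWithin]
    exact derivWithin_congr (fun τ hτ => congrFun (heq τ hτ) x) (congrFun (heq t ht) x)
  have hm₁ := h₁.momentum t ht x
  have hm₂ := h₂.momentum t ht x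
  rw [hd, heq t ht] at hm₁
  have h12 := hm₁.symm.trans hm₂
  simpa using h12

/-- **Pressures with the same velocity differ by a function of time (same time set).** Under the
hypotheses of `gradient_pressure_eq_of_eqOn`, `p₁(t, x) − p₁(t, x₀) = p₂(t, x) − p₂(t, x₀)`: the
lift of `p₁(t) − p₂(t)` has zero derivative, hence is constant (Mathlib
`is_const_of_fderiv_eq_zero`). [cite: RobinsonRodrigoSadowskiCUP2016, §8.1] -/
theorem IsClassicalNSSolutionOn.pressure_sub_eq_of_eqOn
    (h₁ : IsClassicalNSSolutionOn S ν f u₁ p₁) (h₂ : IsClassicalNSSolutionOn S ν f u₂ p₂)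
    (heq : ∀ τ ∈ S, u₁ τ = u₂ τ) {t : ℝ} (ht : t ∈ S) (x x₀ : UnitAddTorus d) :
    p₁ t x - p₁ t x₀ = p₂ t x - p₂ t x₀ := by
  have hp₁ : IsSmooth (p₁ t) := h₁.smooth_pressure.isSmooth_slice ht
  have hp₂ : IsSmooth (p₂ t) := h₂.smooth_pressure.isSmooth_slice ht
  have hψ : IsSmooth (p₁ t - p₂ t) := hp₁.sub hp₂
  have hg0 : ∀ y, Torus.gradient (p₁ t - p₂ t) y = 0 := fun y => by
    rw [gradient_sub (hp₁.isContDiff (by simp)) (hp₂.isContDiff (by simp)),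
      h₁.gradient_pressure_eq_of_eqOn h₂ heq ht y, sub_self]
  have hD : Differentiable ℝ (lift (p₁ t - p₂ t)) := ContDiff.differentiable hψ (by simp)
  have hzero : ∀ y, _root_.fderiv ℝ (lift (p₁ t - p₂ t)) y = 0 := fun y => by
    rw [fderiv_lift]
    ext w
    rw [← inner_gradient_left, hg0]
    simp
  have hc := is_const_of_fderiv_eq_zero hD hzero (repr x) (repr x₀)
  rw [lift_repr, lift_repr, Pi.sub_apply, Pi.sub_apply] at hc
  linarith

end SameSet

/-! ## Locality in time on an arbitrary time set -/

section Local

/-- **Classical solutions are local in time (any time set).** Let `(u, p)` be a pair of fields on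
the time set `S` such that every `t ∈ S` has an open neighbourhood `V` and a classical solution
`(u', p')` on `S ∩ V` (same viscosity and force) with `u' = u`, `p' = p` on `S ∩ V`. Then `(u, p)`
is a classical solution on `S`: joint smoothness is local (Mathlib `contDiffOn_of_locally_contDiffOn`
with the open set `V × ℝᵈ`), and the time derivative within `S` at `t` equals the one within
`S ∩ V` (`derivWithin_inter`), which only sees `u = u'` there. Relatively-open twin of
`Torus.IsClassicalNSSolutionOn.of_local`. [cite: RobinsonRodrigoSadowskiCUP2016, §8.1] -/
theorem IsClassicalNSSolutionOn.of_local_within {S : Set ℝ}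
    {u : ℝ → UnitAddTorus d → EuclideanSpace ℝ d} {p : ℝ → UnitAddTorus d → ℝ}
    (h : ∀ t ∈ S, ∃ V : Set ℝ, IsOpen V ∧ t ∈ V ∧
      ∃ (u' : ℝ → UnitAddTorus d → EuclideanSpace ℝ d) (p' : ℝ → UnitAddTorus d → ℝ),
        IsClassicalNSSolutionOn (S ∩ V) ν f u' p' ∧ (∀ s ∈ S ∩ V, u' s = u s) ∧
          (∀ s ∈ S ∩ V, p' s = p s)) :
    IsClassicalNSSolutionOn S ν f u p := by
  have hset : ∀ V : Set ℝ,
      (S ×ˢ (univ : Set (EuclideanSpace ℝ d))) ∩ V ×ˢ univ = (S ∩ V) ×ˢ univ := fun V => by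
    rw [prod_inter_prod, inter_self]
  refine ⟨?_, ?_, fun t ht x => ?_, fun t ht => ?_⟩
  · refine contDiffOn_of_locally_contDiffOn fun z hz => ?_
    obtain ⟨t, y⟩ := z
    obtain ⟨V, hV, htV, u', p', h', hu', -⟩ := h t (mem_prod.1 hz).1
    refine ⟨V ×ˢ univ, hV.prod isOpen_univ, ⟨htV, mem_univ _⟩, ?_⟩
    rw [hset V]
    exact h'.smooth_velocity.congr fun z hz => by
      obtain ⟨τ, y'⟩ := z
      simp only [stLift_apply, hu' τ (mem_prod.1 hz).1]
  · refine contDiffOn_of_locally_contDiffOn fun z hz => ?_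
    obtain ⟨t, y⟩ := z
    obtain ⟨V, hV, htV, u', p', h', -, hp'⟩ := h t (mem_prod.1 hz).1
    refine ⟨V ×ˢ univ, hV.prod isOpen_univ, ⟨htV, mem_univ _⟩, ?_⟩
    rw [hset V]
    exact h'.smooth_pressure.congr fun z hz => by
      obtain ⟨τ, y'⟩ := z
      simp only [stLift_apply, hp' τ (mem_prod.1 hz).1]
  · obtain ⟨V, hV, htV, u', p', h', hu', hp'⟩ := h t ht
    have htV' : t ∈ S ∩ V := ⟨ht, htV⟩
    have hD : timeDerivWithin S u t x = timeDerivWithin (S ∩ V) u' t x := by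
      simp only [timeDerivWithin]
      calc derivWithin (fun τ => u τ x) S t
          = derivWithin (fun τ => u τ x) (S ∩ V) t := (derivWithin_inter (hV.mem_nhds htV)).symm
        _ = derivWithin (fun τ => u' τ x) (S ∩ V) t :=
            derivWithin_congr (fun τ hτ => congrFun (hu' τ hτ).symm x)
              (congrFun (hu' t htV').symm x)
    rw [hD, ← hu' t htV', ← hp' t htV']
    exact h'.momentum t htV' x
  · obtain ⟨V, -, htV, u', p', h', hu', -⟩ := h t ht
    rw [← hu' t ⟨ht, htV⟩]
    exact h'.divFree t ⟨ht, htV⟩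

end Local

/-! ## Patching finite horizons -/

section Patching

variable {u₀ : UnitAddTorus d → EuclideanSpace ℝ d}

/-- **Uniqueness on the common half-open horizon**: two classical solutions on `[0, T₁) × 𝕋ᵈ` and
`[0, T₂) × 𝕋ᵈ` (viscosity `ν ≥ 0`, same force) with the same datum agree for
`0 ≤ t < min T₁ T₂` (`velocity_unique` on `[0, t]`). [cite: MajdaBertozziCUP2002, Cor. 3.1] -/
theorem IsClassicalNSSolutionOn.eq_on_Ico (hν : 0 ≤ ν) {T₁ T₂ : ℝ}
    {u₁ u₂ : ℝ → UnitAddTorus d → EuclideanSpace ℝ d} {p₁ p₂ : ℝ → UnitAddTorus d → ℝ}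
    (h₁ : IsClassicalNSSolutionOn (Ico 0 T₁) ν f u₁ p₁)
    (h₂ : IsClassicalNSSolutionOn (Ico 0 T₂) ν f u₂ p₂) (h0 : u₁ 0 = u₂ 0) {t : ℝ}
    (ht₁ : t ∈ Ico 0 T₁) (ht₂ : t < T₂) : u₁ t = u₂ t := by
  rcases eq_or_lt_of_le ht₁.1 with h | h
  · rw [← h]; exact h0
  · have h₁' := h₁.mono (Icc_subset_Ico_right ht₁.2) (uniqueDiffOn_Icc h)
    have h₂' := h₂.mono (Icc_subset_Ico_right ht₂) (uniqueDiffOn_Icc h)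
    exact h₁'.velocity_unique hν h₂' h0 ⟨h.le, le_rfl⟩

/-- **Patching finite horizons to `[0, ∞)`.** If for every `T > 0` the Cauchy problem on the flat
torus (viscosity `ν ≥ 0`, force `f`, datum `u₀`) has a classical solution on `[0, T) × 𝕋ᵈ`, then
it has a classical solution on `[0, ∞) × 𝕋ᵈ`, with pressure normalised to vanish at the base
point `x₀`. Proof: choose a solution `(Uₙ, Pₙ)` with horizon `n + 1` for each `n : ℕ`; by
`eq_on_Ico` they agree on common horizons; put `u(t) = U_{⌊t⌋₊}(t)`,
`p(t, x) = P_{⌊t⌋₊}(t, x) − P_{⌊t⌋₊}(t, x₀)`; on `[0, n + 1)` this pair IS `(Uₙ, Pₙ − Pₙ(·, x₀))`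
(`pressure_sub_eq_of_eqOn`), so it is a classical solution by locality (`of_local_within` with
`V = (−∞, n + 1)`, `n = ⌊t⌋₊`). This is the tacit last step of every continuation argument
("restart, identify on the overlap, iterate"). [cite: RobinsonRodrigoSadowskiCUP2016, §8.1] -/
theorem IsClassicalNSSolutionOn.exists_Ici_of_forall_Ico (hν : 0 ≤ ν)
    (h : ∀ T : ℝ, 0 < T →
      ∃ (u : ℝ → UnitAddTorus d → EuclideanSpace ℝ d) (p : ℝ → UnitAddTorus d → ℝ),
        IsClassicalNSSolutionOn (Ico 0 T) ν f u p ∧ u 0 = u₀)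
    (x₀ : UnitAddTorus d) :
    ∃ (u : ℝ → UnitAddTorus d → EuclideanSpace ℝ d) (p : ℝ → UnitAddTorus d → ℝ),
      IsClassicalNSSolutionOn (Ici 0) ν f u p ∧ u 0 = u₀ ∧ ∀ t, p t x₀ = 0 := by
  classical
  have hn : ∀ n : ℕ, ∃ (u : ℝ → UnitAddTorus d → EuclideanSpace ℝ d) (p : ℝ → UnitAddTorus d → ℝ),
      IsClassicalNSSolutionOn (Ico 0 ((n : ℝ) + 1)) ν f u p ∧ u 0 = u₀ :=
    fun n => h _ (by positivity)
  choose U P hU hU0 using hn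
  -- consecutive choices agree on common horizons
  have hagree : ∀ m n : ℕ, ∀ t ∈ Ico (0 : ℝ) ((m : ℝ) + 1), t < (n : ℝ) + 1 → U m t = U n t :=
    fun m n t ht htn => (hU m).eq_on_Ico hν (hU n) ((hU0 m).trans (hU0 n).symm) ht htn
  -- the horizon used at time `t` is `⌊t⌋₊ + 1`
  have hmem : ∀ t : ℝ, 0 ≤ t → t ∈ Ico (0 : ℝ) ((⌊t⌋₊ : ℝ) + 1) := fun t ht =>
    ⟨ht, Nat.lt_floor_add_one t⟩
  have hfloor : ∀ {t : ℝ} {n : ℕ}, 0 ≤ t → t < (n : ℝ) + 1 → (⌊t⌋₊ : ℝ) + 1 ≤ (n : ℝ) + 1 :=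
    fun {t} {n} ht htn => by
      have hlt : ⌊t⌋₊ < n + 1 := (Nat.floor_lt ht).2 (by exact_mod_cast htn)
      have hle : ⌊t⌋₊ ≤ n := Nat.lt_add_one_iff.1 hlt
      exact_mod_cast Nat.add_le_add_right hle 1
  refine ⟨fun t => U ⌊t⌋₊ t, fun t x => P ⌊t⌋₊ t x - P ⌊t⌋₊ t x₀, ?_, ?_, fun t => sub_self _⟩
  · refine IsClassicalNSSolutionOn.of_local_within fun t ht => ?_
    have ht0 : (0 : ℝ) ≤ t := ht
    refine ⟨Iio ((⌊t⌋₊ : ℝ) + 1), isOpen_Iio, Nat.lt_floor_add_one t, U ⌊t⌋₊,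
      fun s x => P ⌊t⌋₊ s x - P ⌊t⌋₊ s x₀, ?_, ?_, ?_⟩
    · rw [Ici_inter_Iio]
      exact (hU ⌊t⌋₊).sub_pressure_apply x₀
    · rintro s ⟨hs0, hsn⟩
      exact (hagree ⌊s⌋₊ ⌊t⌋₊ s (hmem s hs0) hsn).symm
    · rintro s ⟨hs0, hsn⟩
      have hs0' : (0 : ℝ) ≤ s := hs0
      funext x
      have hsub : Ico (0 : ℝ) ((⌊s⌋₊ : ℝ) + 1) ⊆ Ico 0 ((⌊t⌋₊ : ℝ) + 1) :=
        Ico_subset_Ico_right (hfloor hs0' hsn)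
      have hn' := (hU ⌊t⌋₊).mono hsub (uniqueDiffOn_Ico 0 _)
      have heq : ∀ τ ∈ Ico (0 : ℝ) ((⌊s⌋₊ : ℝ) + 1), U ⌊s⌋₊ τ = U ⌊t⌋₊ τ := fun τ hτ =>
        hagree ⌊s⌋₊ ⌊t⌋₊ τ hτ (hτ.2.trans_le (hfloor hs0' hsn))
      exact ((hU ⌊s⌋₊).pressure_sub_eq_of_eqOn hn' heq (hmem s hs0') x x₀).symm
  · show U ⌊(0 : ℝ)⌋₊ 0 = u₀
    rw [Nat.floor_zero]
    exact hU0 0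

/-- **Global smooth solvability ⇔ smooth solvability on every finite horizon `[0, T)`** (flat
torus, viscosity `ν ≥ 0`, force `f`, datum `u₀`): patching (`exists_Ici_of_forall_Ico`) and
restriction (`mono`). [cite: RobinsonRodrigoSadowskiCUP2016, §8.1] -/
theorem IsClassicalNSSolutionOn.exists_Ici_iff_forall_Ico (hν : 0 ≤ ν) :
    (∃ (u : ℝ → UnitAddTorus d → EuclideanSpace ℝ d) (p : ℝ → UnitAddTorus d → ℝ),
        IsClassicalNSSolutionOn (Ici 0) ν f u p ∧ u 0 = u₀) ↔
      ∀ T : ℝ, 0 < T →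
        ∃ (u : ℝ → UnitAddTorus d → EuclideanSpace ℝ d) (p : ℝ → UnitAddTorus d → ℝ),
          IsClassicalNSSolutionOn (Ico 0 T) ν f u p ∧ u 0 = u₀ := by
  constructor
  · rintro ⟨u, p, hcl, h0⟩ T _
    exact ⟨u, p, hcl.mono Ico_subset_Ici_self (uniqueDiffOn_Ico 0 T), h0⟩
  · intro h
    obtain ⟨u, p, hcl, h0, -⟩ := IsClassicalNSSolutionOn.exists_Ici_of_forall_Ico hν h 0
    exact ⟨u, p, hcl, h0⟩

/-- **Global smooth solvability ⇔ smooth solvability on every closed slab `[0, T]`** (flat torus,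
`ν ≥ 0`): a solution on `[0, T]` restricts to `[0, T)`; patch. [cite: RobinsonRodrigoSadowskiCUP2016, §8.1] -/
theorem IsClassicalNSSolutionOn.exists_Ici_iff_forall_Icc (hν : 0 ≤ ν) :
    (∃ (u : ℝ → UnitAddTorus d → EuclideanSpace ℝ d) (p : ℝ → UnitAddTorus d → ℝ),
        IsClassicalNSSolutionOn (Ici 0) ν f u p ∧ u 0 = u₀) ↔
      ∀ T : ℝ, 0 < T →
        ∃ (u : ℝ → UnitAddTorus d → EuclideanSpace ℝ d) (p : ℝ → UnitAddTorus d → ℝ),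
          IsClassicalNSSolutionOn (Icc 0 T) ν f u p ∧ u 0 = u₀ := by
  constructor
  · rintro ⟨u, p, hcl, h0⟩ T hT
    exact ⟨u, p, hcl.mono Icc_subset_Ici_self (uniqueDiffOn_Icc hT), h0⟩
  · intro h
    refine (IsClassicalNSSolutionOn.exists_Ici_iff_forall_Ico hν).2 fun T hT => ?_
    obtain ⟨u, p, hcl, h0⟩ := h T hT
    exact ⟨u, p, hcl.mono Ico_subset_Icc_self (uniqueDiffOn_Ico 0 T), h0⟩

end Patching

end Torus

end Literature.Analysis.FunctionSpaces

end

-- WHAT THIS IS NOT: not a claim about NS regularity or blow-up; not a claim about any author beyond the typed locator.
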